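import Summits.BirchSwinnertonDyer.Rank1Residual.Additive.SplitMultiplicativeUnramifiedWitness
import Literature.NumberTheory.EllipticCurves.TateUniformisation
import HarnessLib

/-!
# Tate data with unramified `p`-torsion: `p ∣ ord_v(q)`, and the Tamagawa witness from it
# (cell `b2b-bsdres`, team n1011, seat p16 GEN 4; row T-BUD5-K = FILE 5 K-GENERAL of the budget
# programme T-E3g-BUD0 / BUDn (n1011-p10); skeleton `cells/n1011/skel/T-BUD5-K.md`, step 4, the
# glue between the Tate route and Kodaira–Néron)

HONEST FRAMING (cell `b2b-bsdres`, run/shared/lean/b2b/bsd-rank1-residual/, verbatim in every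
file): the goal of the cell is to DELETE the COMBINATION-SHAPED residual classes of the
Birch–Swinnerton-Dyer formula for ALL analytic-rank `≤ 1` elliptic curves over `ℚ` — "full BSD
formula for every rank `≤ 1` curve in class `C`" assembled STRICTLY from published theorems — so
that the rank-`≤ 1` remainder becomes exactly the CONSTRUCTION-SHAPED classes, which are TYPED
(missing-input `Prop`s), NOT attempted. This is not "finishing BSD". Team n1011 (N10 / N11, the
Route-G budget node): research route; no claim beyond the stated classes; nothing is booked; marks
UNCHANGED. Theorems only: no definition, no named fact, no `sorry`; Tate data enter as EXPLICIT
HYPOTHESES (the shape of `Silverman1994_thmV53_tateUniformisation`), so nothing is conditional.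

## What and why

`SplitMultiplicativeUnramifiedWitness.lean` (this seat) produces n1011-p10's Tamagawa witness
`∃ u ∈ H¹_ur(K_v, E[p]), u ∉ 𝓚_v` at a place `v ∤ p` carrying Tate data `(q, Φ)` with `q = u · r^p`
("`p ∣ ord_v(q)`"). The census / Kodaira datum is instead `p ∣ c_v = ord_v(Δ_min)`, and the identity
`ord_v(q) = ord_v(Δ_min)` for Tate's `q` is not in the tree. This file RE-LOCATES that gap onto the
torsion: **if every `p`-torsion point of `E(K̄_v)` is fixed by the inertia group, then `q = u · r^p`**
(`exists_unit_mul_pow_eq_of_tateData_of_forall_inertia_smul_torsion`: for a `p`-th root `x` of `q`,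
`Φ(x)` is `p`-torsion, hence inertia-fixed, hence — kernel `q^ℤ`, `(q^k)^p = τ(q)/q = 1 ⇒ k = 0` —
`x` is inertia-fixed, so `x ∈ K_v^{nr}` has `|x| = |ϖ|^n` and `u = q/ϖ^{pn}` is a unit), whence the
witness (`exists_mem_unramifiedSubgroup_not_mem_kummerLocalConditionAt_of_tateData_of_torsion`).
What then remains of "`p ∣ c_v` at a split multiplicative `v ∤ p` ⟹ witness" is exactly ONE
Kodaira–Néron statement — **at a split multiplicative `v ∤ p` with `p ∣ ord_v(Δ_min)` the inertia
group acts trivially on `E[p]`** (Silverman *ATAEC* Ex. 5.13 (b); the CONVERSE of the tree's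
`exists_inertia_map_ne_of_multiplicative`, `MultiplicativeRamifiedTorsionProofs.lean`) — NOT proved
here and said plainly.

References: J. H. Silverman, *ATAEC*, GTM 151, V.3.1, V.5.3, Ex. 5.13; R. Greenberg, LNM 1716 (1999)
p. 74; J.-P. Serre, *Local Fields*, IV §4 Prop. 16 and Cor. 2.
-/

noncomputable section

open scoped Classical

namespace WeierstrassCurve

open Literature.NumberTheory.EllipticCurves Literature.NumberTheory.GaloisRepresentations Field
open Literature.NumberTheory.GaloisRepresentations.IsNonarchimedeanLocalField
open NumberField IsDedekindDomain ValuativeRel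

section Local

variable {K : Type} [Field K] [NumberField K] (W : WeierstrassCurve K)
  {p : ℕ} [hp : Fact p.Prime] (v : HeightOneSpectrum (𝓞 K))

/-- **Tate data with INERTIA-TRIVIAL `p`-torsion force `p ∣ ord_v(q)`** (the glue between the
Kodaira–Néron side and the Tate side of the Tamagawa witness): if `(q, Φ)` is Tate data for `W` at
`v` and every `p`-torsion point of `E(K̄_v)` is fixed by the inertia group, then `q = u · r^p` with
`u` a unit of `𝒪_{K_v}` — for a `p`-th root `x` of `q`, `Φ(x)` is `p`-torsion, hence inertia-fixed,
hence (kernel `q^ℤ` and `(q^k)^p = τ(q)/q = 1 ⇒ k = 0`) `x` itself is inertia-fixed, so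
`x ∈ K_v^{nr}` has `|x| = |ϖ|^n` (`exists_algNorm_eq_zpow_of_mem_maxUnramified`), `|q| = |ϖ|^{pn}`,
and `u = q / ϖ^{pn}` is a unit. (Silverman *ATAEC* V §4–§5: `E_q[p] = ⟨ζ_p, q^{1/p}⟩ / q^ℤ`; with
`exists_point_forall_root_not_fixed_of_tateData` this reduces the split-multiplicative witness to
the unramifiedness of `E[p]` when `p ∣ ord_v(Δ_min)`, the converse of the tree's
`exists_inertia_map_ne_of_multiplicative`.) [cite: SilvermanATAEC1994, Ch. V Thm. 3.1 (c),(d) and Thm. 5.3 (a),(b)]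
[cite: SerreLocalFields1979, Ch. IV §4 Prop. 16 and Cor. 2] -/
theorem exists_unit_mul_pow_eq_of_tateData_of_forall_inertia_smul_torsion
    {q : v.adicCompletion K} (hq0 : q ≠ 0) (hq1 : Valued.v q < 1)
    (Φ : Additive (AlgebraicClosure (v.adicCompletion K))ˣ →+ localPoints W (v.adicCompletion K))
    (hker : ∀ u : (AlgebraicClosure (v.adicCompletion K))ˣ, Φ (Additive.ofMul u) = 0 ↔ ∃ n : ℤ,
        (u : AlgebraicClosure (v.adicCompletion K)) =
          algebraMap (v.adicCompletion K) (AlgebraicClosure (v.adicCompletion K)) q ^ n)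
    (hequiv : ∀ (σ : absoluteGaloisGroup (v.adicCompletion K))
        (u : (AlgebraicClosure (v.adicCompletion K))ˣ),
      σ • Φ (Additive.ofMul u) =
        Φ (Additive.ofMul (Units.map (absoluteGaloisGroup.toAlgEquiv _ σ :
          AlgebraicClosure (v.adicCompletion K) →* _) u)))
    (hI : ∀ Q : localPoints W (v.adicCompletion K), (p : ℤ) • Q = 0 →
      ∀ τ ∈ absInertia (v.adicCompletion K), τ • Q = Q) :
    ∃ (u : (𝒪[v.adicCompletion K])ˣ) (r : v.adicCompletion K),
      q = ((u : 𝒪[v.adicCompletion K]) : v.adicCompletion K) * r ^ p := by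
  haveI : CharZero (v.adicCompletion K) := charZero_adicCompletion v
  have hpp : p.Prime := hp.out
  have hιinj : Function.Injective
      (algebraMap (v.adicCompletion K) (AlgebraicClosure (v.adicCompletion K))) :=
    (algebraMap (v.adicCompletion K) (AlgebraicClosure (v.adicCompletion K))).injective
  set qb : AlgebraicClosure (v.adicCompletion K) :=
    algebraMap (v.adicCompletion K) (AlgebraicClosure (v.adicCompletion K)) q with hqb
  have hqb0 : qb ≠ 0 := by rw [hqb, map_ne_zero_iff _ hιinj]; exact hq0
  -- a `p`-th root `x` of `q` in `K̄_v`; `Φ(x)` is `p`-torsion, hence inertia-fixed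
  obtain ⟨x0, hx0p⟩ := IsAlgClosed.exists_pow_nat_eq qb hpp.pos
  have hx00 : x0 ≠ 0 := by
    rintro rfl
    rw [zero_pow hpp.ne_zero] at hx0p
    exact hqb0 hx0p.symm
  set x : (AlgebraicClosure (v.adicCompletion K))ˣ := Units.mk0 x0 hx00 with hx
  have hxval : (x : AlgebraicClosure (v.adicCompletion K)) = x0 := rfl
  have hxpow : (x : AlgebraicClosure (v.adicCompletion K)) ^ p = qb := by rw [hxval, hx0p]
  have hQtor : (p : ℤ) • Φ (Additive.ofMul x) = 0 := by
    rw [← map_zsmul, ← ofMul_zpow, hker]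
    exact ⟨1, by rw [Units.val_zpow_eq_zpow_val, zpow_natCast, hxpow, zpow_one]⟩
  have hQfix := hI _ hQtor
  -- every `τ ∈ I_{K_v}` fixes `x`
  have hxfix : ∀ τ ∈ absInertia (v.adicCompletion K),
      τ • (x : AlgebraicClosure (v.adicCompletion K)) = x := by
    intro τ hτ
    have h1 : Φ (Additive.ofMul (Units.map (absoluteGaloisGroup.toAlgEquiv (v.adicCompletion K) τ :
        AlgebraicClosure (v.adicCompletion K) →* _) x * x⁻¹)) = 0 := by
      rw [ofMul_mul, ofMul_inv, map_add, map_neg, ← hequiv, hQfix τ hτ, add_neg_cancel]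
    obtain ⟨k, hk⟩ := (hker _).mp h1
    have hxne : (x : AlgebraicClosure (v.adicCompletion K)) ≠ 0 := x.ne_zero
    have hτx : (absoluteGaloisGroup.toAlgEquiv (v.adicCompletion K) τ)
        (x : AlgebraicClosure (v.adicCompletion K)) =
          (x : AlgebraicClosure (v.adicCompletion K)) * qb ^ k := by
      have h2 : ((Units.map (absoluteGaloisGroup.toAlgEquiv (v.adicCompletion K) τ :
          AlgebraicClosure (v.adicCompletion K) →* _) x * x⁻¹ :
            (AlgebraicClosure (v.adicCompletion K))ˣ) : AlgebraicClosure (v.adicCompletion K)) =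
          (absoluteGaloisGroup.toAlgEquiv (v.adicCompletion K) τ)
            (x : AlgebraicClosure (v.adicCompletion K)) * (x : AlgebraicClosure (v.adicCompletion K))⁻¹ := by
        rw [Units.val_mul, Units.val_inv_eq_inv_val]; rfl
      rw [h2, hqb] at hk
      calc (absoluteGaloisGroup.toAlgEquiv (v.adicCompletion K) τ) (x : AlgebraicClosure (v.adicCompletion K))
          = (absoluteGaloisGroup.toAlgEquiv (v.adicCompletion K) τ)
              (x : AlgebraicClosure (v.adicCompletion K)) *
              (x : AlgebraicClosure (v.adicCompletion K))⁻¹ * x := by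
            rw [mul_assoc, inv_mul_cancel₀ hxne, mul_one]
        _ = (x : AlgebraicClosure (v.adicCompletion K)) * qb ^ k := by rw [hk, hqb, mul_comm]
    have hfixp : (absoluteGaloisGroup.toAlgEquiv (v.adicCompletion K) τ)
        ((x : AlgebraicClosure (v.adicCompletion K)) ^ p) =
          (x : AlgebraicClosure (v.adicCompletion K)) ^ p := by
      rw [hxpow, hqb, AlgEquiv.commutes]
    have hxp0 : (x : AlgebraicClosure (v.adicCompletion K)) ^ p ≠ 0 := pow_ne_zero _ hxne
    have hqk : qb ^ (k * p) = 1 := by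
      have h3 : ((absoluteGaloisGroup.toAlgEquiv (v.adicCompletion K) τ)
          (x : AlgebraicClosure (v.adicCompletion K))) ^ p =
            (x : AlgebraicClosure (v.adicCompletion K)) ^ p := by
        rw [← map_pow]; exact hfixp
      rw [hτx, mul_pow, ← zpow_natCast (qb ^ k), ← zpow_mul] at h3
      have h4 : (x : AlgebraicClosure (v.adicCompletion K)) ^ p * qb ^ (k * (p : ℤ)) =
          (x : AlgebraicClosure (v.adicCompletion K)) ^ p * 1 := by rw [mul_one]; exact h3
      exact mul_left_cancel₀ hxp0 h4
    have hk0 : k * (p : ℤ) = 0 := by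
      rw [hqb] at hqk
      exact zpow_algebraMap_eq_one_imp v hq0 hq1 hqk
    have hk00 : k = 0 := by
      rcases mul_eq_zero.mp hk0 with h | h
      · exact h
      · exact absurd (by exact_mod_cast h : p = 0) hpp.ne_zero
    rw [absoluteGaloisGroup.smul_def, hτx, hk00, zpow_zero, mul_one]
  -- `x ∈ K_v^{nr}`, `|x| = |ϖ|^n`, `|q| = |ϖ|^{pn}`
  obtain ⟨ϖ, hϖ⟩ := IsDiscreteValuationRing.exists_irreducible (𝒪[v.adicCompletion K])
  have hxmem : (x : AlgebraicClosure (v.adicCompletion K)) ∈ maxUnramified (v.adicCompletion K) :=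
    mem_maxUnramified_of_forall_absInertia v hxfix
  obtain ⟨n, hn⟩ := exists_algNorm_eq_zpow_of_mem_maxUnramified hϖ hxmem x.ne_zero
  set N := algNorm (v.adicCompletion K)
    (algebraMap (𝒪[v.adicCompletion K]) (AlgebraicClosure (v.adicCompletion K)) ϖ) with hN
  have hNpos : 0 < N := algNorm_uniformizer_pos hϖ
  have hN1 : N < 1 := algNorm_uniformizer_lt_one hϖ
  have hnormq : algNorm (v.adicCompletion K) qb = N ^ ((p : ℤ) * n) := by
    rw [← hxpow, algNorm_pow, hn, ← zpow_natCast, ← zpow_mul, mul_comm]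
  -- `r = ϖ^n`, `u = q / r^p`
  have hϖF0 : ((ϖ : 𝒪[v.adicCompletion K]) : v.adicCompletion K) ≠ 0 := fun h0 =>
    hϖ.ne_zero (Subtype.ext h0)
  set r : v.adicCompletion K := ((ϖ : 𝒪[v.adicCompletion K]) : v.adicCompletion K) ^ n with hr
  have hr0 : r ≠ 0 := zpow_ne_zero _ hϖF0
  have hrp0 : r ^ p ≠ 0 := pow_ne_zero _ hr0
  have hNϖ : algNorm (v.adicCompletion K) (algebraMap (v.adicCompletion K)
      (AlgebraicClosure (v.adicCompletion K)) ((ϖ : 𝒪[v.adicCompletion K]) : v.adicCompletion K)) =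
        N := by
    rw [hN, IsScalarTower.algebraMap_apply (𝒪[v.adicCompletion K]) (v.adicCompletion K)
      (AlgebraicClosure (v.adicCompletion K)) ϖ]
    rfl
  have hnormr : algNorm (v.adicCompletion K)
      (algebraMap (v.adicCompletion K) (AlgebraicClosure (v.adicCompletion K)) (r ^ p)) =
        N ^ ((p : ℤ) * n) := by
    rw [hr, map_pow, map_zpow₀, algNorm_pow, IsDedekindDomain.HeightOneSpectrum.algNorm_zpow', hNϖ,
      ← zpow_natCast, ← zpow_mul, mul_comm]
  set u : v.adicCompletion K := q / r ^ p with hu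
  have hnormu : algNorm (v.adicCompletion K)
      (algebraMap (v.adicCompletion K) (AlgebraicClosure (v.adicCompletion K)) u) = 1 := by
    rw [hu, map_div₀, algNorm_div, ← hqb, hnormq, hnormr, div_self (zpow_ne_zero _ hNpos.ne')]
  have hnormu' : algNorm (v.adicCompletion K)
      (algebraMap (v.adicCompletion K) (AlgebraicClosure (v.adicCompletion K)) u⁻¹) = 1 := by
    rw [map_inv₀, algNorm_inv, hnormu, inv_one]
  have hu0 : u ≠ 0 := div_ne_zero hq0 hrp0
  have huO : u ∈ 𝒪[v.adicCompletion K] := algNorm_algebraMap_le_one_iff.mp hnormu.le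
  have huO' : u⁻¹ ∈ 𝒪[v.adicCompletion K] := algNorm_algebraMap_le_one_iff.mp hnormu'.le
  refine ⟨⟨⟨u, huO⟩, ⟨u⁻¹, huO'⟩, Subtype.ext (mul_inv_cancel₀ hu0),
    Subtype.ext (inv_mul_cancel₀ hu0)⟩, r, ?_⟩
  change q = u * r ^ p
  rw [hu, div_mul_cancel₀ q hrp0]

/-- **The Tamagawa witness at a Tate place `v ∤ p`, from UNRAMIFIED `p`-torsion** (composite of
the two previous theorems): Tate data `(q, Φ)` for `W` at `v` + "every `p`-torsion point of `E(K̄_v)`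
is inertia-fixed" give `∃ u ∈ H¹_ur(K_v, E[p]), u ∉ 𝓚_v` (n1011-p10's binder). What is then left of
the split-multiplicative Tamagawa witness is ONE Kodaira–Néron statement — at a split multiplicative
`v ∤ p` with `p ∣ ord_v(Δ_min) = c_v` the inertia group acts trivially on `E[p]` (Silverman *ATAEC*
Ex. 5.13 (b); the converse of the tree's `exists_inertia_map_ne_of_multiplicative`) — not proved here.
[cite: GreenbergLNM1716, §3 p. 74 and Cor. 5.6 (proof)]
[cite: SilvermanATAEC1994, Ch. V Thm. 3.1 (c),(d) and Thm. 5.3 (a),(b)] -/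
theorem exists_mem_unramifiedSubgroup_not_mem_kummerLocalConditionAt_of_tateData_of_torsion
    [W.IsElliptic] (hpv : (p : 𝓞 K) ∉ v.asIdeal)
    {q : v.adicCompletion K} (hq0 : q ≠ 0) (hq1 : Valued.v q < 1)
    (Φ : Additive (AlgebraicClosure (v.adicCompletion K))ˣ →+ localPoints W (v.adicCompletion K))
    (hsurj : Function.Surjective Φ)
    (hker : ∀ u : (AlgebraicClosure (v.adicCompletion K))ˣ, Φ (Additive.ofMul u) = 0 ↔ ∃ n : ℤ,
        (u : AlgebraicClosure (v.adicCompletion K)) =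
          algebraMap (v.adicCompletion K) (AlgebraicClosure (v.adicCompletion K)) q ^ n)
    (hequiv : ∀ (σ : absoluteGaloisGroup (v.adicCompletion K))
        (u : (AlgebraicClosure (v.adicCompletion K))ˣ),
      σ • Φ (Additive.ofMul u) =
        Φ (Additive.ofMul (Units.map (absoluteGaloisGroup.toAlgEquiv _ σ :
          AlgebraicClosure (v.adicCompletion K) →* _) u)))
    (hI : ∀ Q : localPoints W (v.adicCompletion K), (p : ℤ) • Q = 0 →
      ∀ τ ∈ absInertia (v.adicCompletion K), τ • Q = Q) :
    ∃ u ∈ DiscreteGaloisModule.unramifiedSubgroup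
        ((W.torsionGaloisModule (p : ℤ)).restrictField (v.adicCompletion K)) 1,
      u ∉ W.kummerLocalConditionAt (p : ℤ) (v.adicCompletion K) :=
  W.exists_mem_unramifiedSubgroup_not_mem_kummerLocalConditionAt_of_tateData v hpv hq0 hq1 Φ hsurj
    hker hequiv (W.exists_unit_mul_pow_eq_of_tateData_of_forall_inertia_smul_torsion v hq0 hq1 Φ hker
      hequiv hI)

/-! ## Addendum: packaged with Tate's uniformisation (named fact A40) -/

/-- **At a place of SPLIT MULTIPLICATIVE reduction `v ∤ p` where `E[p]` is unramified, the
Tamagawa witness exists — modulo Tate's uniformisation.** Granted the named fact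
`Silverman1994_thmV53_tateUniformisation` (A40; Silverman *ATAEC* V.3.1, V.5.3 — it supplies the Tate
data `(q, Φ)` at `v`), if every `p`-torsion point of `E(K̄_v)` is fixed by the inertia group then
`∃ u ∈ H¹_ur(K_v, E[p])` with `u ∉ 𝓚_v` (n1011-p10's binder `hwit`, any number field `K`). This is
the form the budget assembly consumes per Tamagawa place: its two remaining inputs are A40 (a named
fact, as in every Tate-curve file of the cell) and the unramifiedness of `E[p]` — at a split
multiplicative `v ∤ p` equivalent to `p ∣ ord_v(Δ_min) = c_v` (Silverman *ATAEC* Ex. 5.13 (b); the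
direction `p ∤ ord_v(Δ_min) ⇒` ramified is the tree's `exists_inertia_map_ne_of_multiplicative`, the
converse is NOT in the tree). CONDITIONAL on A40 (hypothesis `hU`); nothing else assumed.
[cite: SilvermanATAEC1994, Ch. V Thm. 3.1 (c),(d) and Thm. 5.3 (a),(b)]
[cite: GreenbergLNM1716, §3 p. 74 and Cor. 5.6 (proof)] -/
theorem exists_mem_unramifiedSubgroup_not_mem_kummerLocalConditionAt_of_tateUniformisation_of_torsion
    [W.IsElliptic] (hU : Silverman1994_thmV53_tateUniformisation.{0})
    (hsplit : W.HasSplitMultiplicativeReductionAt v) (hpv : (p : 𝓞 K) ∉ v.asIdeal)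
    (hI : ∀ Q : localPoints W (v.adicCompletion K), (p : ℤ) • Q = 0 →
      ∀ τ ∈ absInertia (v.adicCompletion K), τ • Q = Q) :
    ∃ u ∈ DiscreteGaloisModule.unramifiedSubgroup
        ((W.torsionGaloisModule (p : ℤ)).restrictField (v.adicCompletion K)) 1,
      u ∉ W.kummerLocalConditionAt (p : ℤ) (v.adicCompletion K) := by
  obtain ⟨q, Φ, hq0, hq1, hsurj, hker, hequiv, -⟩ := hU W v hsplit
  exact W.exists_mem_unramifiedSubgroup_not_mem_kummerLocalConditionAt_of_tateData_of_torsion v hpv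
    hq0 hq1 Φ hsurj hker hequiv hI


end Local

end WeierstrassCurve

/-! ## Erratum (seat n1011-p16 GEN 5, 2026-08-21; documentation only — no declaration above changes)

The sentences in this file that call (L1) — "at a (split) multiplicative place `v ∤ p` with
`p ∣ ord_v(Δ_min)` the inertia group acts trivially on `E[p]`" — "NOT proved in the tree" /
"not in the tree" / "n1011-p14's deal" are RETIRED. (L1) IS a tree theorem, and was when this file
landed: `WeierstrassCurve.smul_eq_of_mem_inertia_of_hasMultiplicativeReductionAt_of_dvd`
(`Literature/NumberTheory/EllipticCurves/MultiplicativeUnramifiedTorsionProofs.lean`, in the tree since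
2026-08-16; Kodaira–Néron over `K_v^nr`, no Tate curve; Serre, Invent. Math. 15 (1972) n° 1.12;
Silverman *ATAEC* Ex. 5.13 (b)), read on `absInertia K_v` through
`IsDedekindDomain.HeightOneSpectrum.inertia_eq_absInertia`
(`KodairaNeronUnramifiedInertiaProofs.lean`). The binder `hI` of this file (every `p`-torsion point of `E(K̄_v)` inertia-fixed) is
thereby discharged from `p ∣ ord_v(Δ_min)`, i.e. from the census datum `p ∣ c_v` at a split
multiplicative place (`localTamagawaNumber_eq_ordMinimalDiscriminant_of_hasSplitMultiplicativeReductionAt`),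
modulo A40 only and with NO `μ_p ⊄ K_v` side condition, in n1011-p01's row T-L1-KN file
`Summits/BirchSwinnertonDyer/Rank1Residual/Additive/SplitMultiplicativeWitnessOfTamagawa.lean` (p276169):
`forall_absInertia_smul_eq_of_dvd_ordMinimalDiscriminant`,
`exists_mem_unramifiedSubgroup_not_mem_kummerLocalConditionAt_of_tateUniformisation_of_split_of_dvd_localTamagawaNumber`
(any number field `K`, any split multiplicative `v ∤ p`) and
`exists_mem_unramifiedSubgroup_not_mem_kummerLocalConditionAt_baseChange_of_split_of_dvd_localTamagawaNumber`
(`V/ℚ` globally minimal, any number field, any place above the Tamagawa prime). The cell's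
"(L1) residual scope" (lead R5-54) is EMPTY. -/

end
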